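import Literature.Probability.Process.BrownianVec
import Literature.Probability.Process.ProgressiveDensity
import Literature.Probability.Process.ItoIntegralStopping
import Mathlib.Probability.ConditionalExpectation
import HarnessLib

/-!
# Route `ColdStartUniversality`, support item S (stmt-QuantumFields-24811), line `piwiener`:
# the coordinates of a `d`-dimensional Brownian motion are `L²` martingales with compensator `t`
# for the JOINT raw natural filtration

Helper file (lead `ym-line-csu-p1`) towards the registered stub `stub_coldStartStrongExistence`
(cold-start strong existence for the SU(2) lattice Langevin SDE on the product Wiener space).  The SZZ
system is driven by the `8·|E|` coordinates `W^{e,n}` of ONE flat Brownian motion and its solutions are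
adapted to the JOINT filtration `𝓕_t = σ(W_s : s ≤ t)` (tree `IsFlatBrownian.natFiltration` =
`IsBrownianVec.natFiltration` after enumeration).  The tree's construction of the Itô integral
(`Literature.Probability.Process.exists_isItoIntegral_of_sqErr_ne_top`, `ProgressiveDensity`) and the
Doob–Itô `L²` maximal inequality behind every Picard iteration
(`IsItoIntegral.lintegral_iSup_sub_sq_le`, `ItoIntegralStopping`) are stated for an ARBITRARY raw
filtration `𝓕` and an `𝓕`-martingale integrator `B` with continuous paths, `B_t ∈ L²` and `B_t² - t`
an `𝓕`-martingale.  This file verifies exactly these hypotheses for each coordinate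
`B = W^i := fun t ω => W t ω i` of a Brownian vector `W` (`IsBrownianVec W P`) with respect to the
joint filtration `hW.natFiltration`:

* `map_coord`, `memLp_two_coord`, `integrable_coord` — `W^i_t ~ N(0, t)`, hence `L²`;
* `indep_comap_coordIncr_natFiltration` — `σ(W^i_{s+h} - W^i_s)` is independent of `𝓕_s` (weak
  Markov property of the VECTOR, `IsBrownianVec.indep_comap_vecShift_natFiltration`);
* `integral_coordIncr`, `integral_coordIncr_sq` — `E[W^i_{s+h} - W^i_s] = 0`, `E[(W^i_{s+h} - W^i_s)²] = h`;
* `condExp_coordIncr`, `condExp_coordIncr_sq` — the same conditionally on `𝓕_s`;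
* `martingale_coord`, `martingale_coord_sq_sub` — **`W^i` and `(W^i)² - t` are `𝓕`-martingales**
  (Revuz–Yor, Ch. II, Prop. (1.2)(i),(ii), for the joint filtration); `continuous_coord`;
* the payoff `exists_isItoIntegral_coord` — **every `𝓕`-progressive integrand `H` with
  `E ∫₀ᵗ H² ds < ∞` has an Itô integral `∫ H dW^i` against EACH coordinate, w.r.t. the JOINT
  filtration**, which is a square-integrable `𝓕`-martingale (vector stochastic integration on the
  flat noise of the lattice Langevin dynamics), and `lintegral_iSup_itoIntegral_coord_sub_sq_le` — the
  Doob–Itô `L²` maximal inequality `E[sup_{s≤t}(J_s - J'_s)²] ≤ 4 E ∫₀ᵗ (H_s - H'_s)² ds` for two such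
  integrals against the same coordinate (the contraction estimate of the Picard iteration).

Pattern of proof: the tree's one-dimensional `martingale_brownian_holds` /
`martingale_brownian_sq_sub_holds` (`LocalMartingaleProofs`).  No definition, no sorry, standard axioms.
RECORD-rung plumbing; nothing here bears on the Yang–Mills mass gap.
-/

set_option autoImplicit false

noncomputable section

namespace Summit.QuantumFields.YangMills.Theorems.ColdStartUniversality

open MeasureTheory ProbabilityTheory Filter
open scoped NNReal
open Literature.Probability.Process

variable {Ω : Type*} {mΩ : MeasurableSpace Ω} {P : Measure Ω} {d : ℕ}
  {W : ℝ≥0 → Ω → (Fin d → ℝ)}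

/-! ### Laws and moments of one coordinate -/

/-- Each coordinate `ω ↦ W t ω i` is measurable. [folklore] -/
theorem measurable_coord (hW : IsBrownianVec W P) (t : ℝ≥0) (i : Fin d) :
    Measurable fun ω => W t ω i :=
  (measurable_pi_apply i).comp (hW.measurable t)

/-- Each coordinate path `t ↦ W t ω i` is continuous. [folklore] -/
theorem continuous_coord (hW : IsBrownianVec W P) (i : Fin d) (ω : Ω) :
    Continuous fun t => W t ω i :=
  (continuous_apply i).comp (hW.continuous_path ω)

/-- **`W^i_t ~ N(0, t)`**: the one-time law of a coordinate of a Brownian vector. [folklore] -/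
theorem map_coord (hW : IsBrownianVec W P) (t : ℝ≥0) (i : Fin d) :
    P.map (fun ω => W t ω i) = gaussianReal 0 t := by
  have h : (fun ω => W t ω i) = (fun ξ : Fin d → ℝ => ξ i) ∘ W t := rfl
  rw [h, ← Measure.map_map (measurable_pi_apply i) (hW.measurable t), hW.map_apply t,
    gaussVec_map_eval]

/-- **The increment `W^i_{s+h} - W^i_s ~ N(0, h)`.** [folklore] -/
theorem map_coordIncr (hW : IsBrownianVec W P) (s h : ℝ≥0) (i : Fin d) :
    P.map (fun ω => W (s + h) ω i - W s ω i) = gaussianReal 0 h := by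
  have h1 : (fun ω => W (s + h) ω i - W s ω i) =
      (fun ξ : Fin d → ℝ => ξ i) ∘ fun ω => W (s + h) ω - W s ω := by
    funext ω; rfl
  have hm : Measurable fun ω => W (s + h) ω - W s ω := (hW.measurable _).sub (hW.measurable _)
  rw [h1, ← Measure.map_map (measurable_pi_apply i) hm, hW.map_incr s h, gaussVec_map_eval]

/-- A real random variable with law `N(0, v)` is in `L²`. [folklore] -/
theorem memLp_two_of_map_eq_gaussianReal {X : Ω → ℝ} (hX : Measurable X) {v : ℝ≥0}
    (hlaw : P.map X = gaussianReal 0 v) : MemLp X 2 P := by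
  have h : MemLp id 2 (P.map X) := by rw [hlaw]; exact memLp_id_gaussianReal 2
  exact (memLp_map_measure_iff h.aestronglyMeasurable hX.aemeasurable).1 h

/-- Each coordinate `W^i_t` is square integrable. [folklore] -/
theorem memLp_two_coord [IsProbabilityMeasure P] (hW : IsBrownianVec W P) (t : ℝ≥0) (i : Fin d) :
    MemLp (fun ω => W t ω i) 2 P :=
  memLp_two_of_map_eq_gaussianReal (measurable_coord hW t i) ((map_coord hW) t i)

/-- Each coordinate `W^i_t` is integrable. [folklore] -/
theorem integrable_coord [IsProbabilityMeasure P] (hW : IsBrownianVec W P) (t : ℝ≥0) (i : Fin d) :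
    Integrable (fun ω => W t ω i) P :=
  ((memLp_two_coord hW) t i).integrable one_le_two

/-- The increment `W^i_{s+h} - W^i_s` is square integrable. [folklore] -/
theorem memLp_two_coordIncr [IsProbabilityMeasure P] (hW : IsBrownianVec W P) (s h : ℝ≥0)
    (i : Fin d) : MemLp (fun ω => W (s + h) ω i - W s ω i) 2 P :=
  memLp_two_of_map_eq_gaussianReal ((measurable_coord hW _ i).sub (measurable_coord hW _ i))
    ((map_coordIncr hW) s h i)

/-- **Centred increments**: `E[W^i_{s+h} - W^i_s] = 0`. [folklore] -/
theorem integral_coordIncr [IsProbabilityMeasure P] (hW : IsBrownianVec W P) (s h : ℝ≥0)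
    (i : Fin d) : ∫ ω, (W (s + h) ω i - W s ω i) ∂P = 0 := by
  have hm : AEMeasurable (fun ω => W (s + h) ω i - W s ω i) P :=
    ((measurable_coord hW _ i).sub (measurable_coord hW _ i)).aemeasurable
  have := integral_map hm (f := fun x : ℝ => x) measurable_id.aestronglyMeasurable
  rw [(map_coordIncr hW) s h i, integral_id_gaussianReal] at this
  simpa using this.symm

/-- **Second moment of the increments**: `E[(W^i_{s+h} - W^i_s)²] = h`. [folklore] -/
theorem integral_coordIncr_sq [IsProbabilityMeasure P] (hW : IsBrownianVec W P) (s h : ℝ≥0)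
    (i : Fin d) : ∫ ω, (W (s + h) ω i - W s ω i) ^ 2 ∂P = h := by
  have hm : AEMeasurable (fun ω => W (s + h) ω i - W s ω i) P :=
    ((measurable_coord hW _ i).sub (measurable_coord hW _ i)).aemeasurable
  have := integral_map hm (f := fun x : ℝ => x ^ 2) (measurable_id.pow_const 2).aestronglyMeasurable
  rw [(map_coordIncr hW) s h i] at this
  rw [← this]
  have hv := variance_of_integral_eq_zero (μ := gaussianReal 0 h) (X := id) measurable_id.aemeasurable
    (by simp [integral_id_gaussianReal])
  rw [variance_id_gaussianReal] at hv
  simpa using hv.symm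

/-! ### Independence of the increments from the joint past -/

/-- The coordinate increment `W^i_{s+h} - W^i_s` is measurable for the σ-algebra of the shifted VECTOR
path `u ↦ W_{s+u} - W_s`. [folklore] -/
theorem measurable_coordIncr_comap (s h : ℝ≥0) (i : Fin d) :
    Measurable[MeasurableSpace.comap (vecShift W s) inferInstance] fun ω => W (s + h) ω i - W s ω i := by
  have h1 : (fun ω => W (s + h) ω i - W s ω i) =
      (fun p : ℝ≥0 → (Fin d → ℝ) => p h i) ∘ vecShift W s := by
    funext ω; rfl
  rw [h1]
  exact ((measurable_pi_apply i).comp (measurable_pi_apply h)).comp (comap_measurable (vecShift W s))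

/-- **The coordinate increment after time `s` is independent of the joint past `𝓕_s`** (weak Markov
property of the Brownian VECTOR at the deterministic time `s`, restricted to one coordinate).
Revuz–Yor (1999), Ch. III §3; Le Gall (2016), Ch. 2. [folklore] -/
theorem indep_comap_coordIncr_natFiltration (hW : IsBrownianVec W P) (s h : ℝ≥0) (i : Fin d) :
    Indep (MeasurableSpace.comap (fun ω => W (s + h) ω i - W s ω i) inferInstance)
      (hW.natFiltration s) P :=
  indep_of_indep_of_le_left (hW.indep_comap_vecShift_natFiltration s)
    (measurable_coordIncr_comap s h i).comap_le

/-- **Increments are conditionally centred**: `E[W^i_{s+h} - W^i_s | 𝓕_s] = 0` a.s. [folklore] -/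
theorem condExp_coordIncr [IsProbabilityMeasure P] (hW : IsBrownianVec W P) (s h : ℝ≥0)
    (i : Fin d) :
    P[fun ω => W (s + h) ω i - W s ω i | hW.natFiltration s] =ᵐ[P] 0 := by
  have hmeas : Measurable fun ω => W (s + h) ω i - W s ω i :=
    (measurable_coord hW _ i).sub (measurable_coord hW _ i)
  have hc := condExp_indep_eq
    (m₁ := MeasurableSpace.comap (fun ω => W (s + h) ω i - W s ω i) inferInstance)
    (μ := P) (f := fun ω => W (s + h) ω i - W s ω i)
    (measurable_iff_comap_le.1 hmeas) (hW.natFiltration.le s)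
    (Measurable.stronglyMeasurable (measurable_iff_comap_le.2 le_rfl))
    ((indep_comap_coordIncr_natFiltration hW) s h i)
  refine hc.trans (Eventually.of_forall fun ω => ?_)
  simp only [Pi.zero_apply]
  exact (integral_coordIncr hW) s h i

/-- **Conditional second moment**: `E[(W^i_{s+h} - W^i_s)² | 𝓕_s] = h` a.s. [folklore] -/
theorem condExp_coordIncr_sq [IsProbabilityMeasure P] (hW : IsBrownianVec W P) (s h : ℝ≥0)
    (i : Fin d) :
    P[fun ω => (W (s + h) ω i - W s ω i) ^ 2 | hW.natFiltration s] =ᵐ[P] fun _ => (h : ℝ) := by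
  have hmeas : Measurable fun ω => W (s + h) ω i - W s ω i :=
    (measurable_coord hW _ i).sub (measurable_coord hW _ i)
  have hsq : Measurable[MeasurableSpace.comap (fun ω => W (s + h) ω i - W s ω i) inferInstance]
      (fun ω => (W (s + h) ω i - W s ω i) ^ 2) :=
    (measurable_iff_comap_le.2 le_rfl).pow_const 2
  have hc := condExp_indep_eq
    (m₁ := MeasurableSpace.comap (fun ω => W (s + h) ω i - W s ω i) inferInstance)
    (μ := P) (f := fun ω => (W (s + h) ω i - W s ω i) ^ 2)
    (measurable_iff_comap_le.1 hmeas) (hW.natFiltration.le s) hsq.stronglyMeasurable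
    ((indep_comap_coordIncr_natFiltration hW) s h i)
  refine hc.trans (Eventually.of_forall fun ω => ?_)
  exact (integral_coordIncr_sq hW) s h i

/-! ### The two martingales -/

/-- The coordinate process is strongly adapted to the joint natural filtration. [folklore] -/
theorem stronglyAdapted_coord (hW : IsBrownianVec W P) (i : Fin d) :
    StronglyAdapted hW.natFiltration fun t ω => W t ω i := fun t =>
  ((measurable_pi_apply i).comp (hW.stronglyAdapted t).measurable).stronglyMeasurable

/-- **Each coordinate of a Brownian vector is a martingale for the JOINT raw natural filtration.**
`W^i_t = W^i_s + (W^i_t - W^i_s)` with `W^i_s` `𝓕_s`-measurable and `E[W^i_t - W^i_s | 𝓕_s] = 0`.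
Revuz–Yor, *Continuous Martingales and Brownian Motion* (1999), Ch. II, Prop. (1.2)(i). -/
theorem martingale_coord [IsProbabilityMeasure P] (hW : IsBrownianVec W P) (i : Fin d) :
    Martingale (fun t ω => W t ω i) hW.natFiltration P := by
  refine ⟨(stronglyAdapted_coord hW) i, fun s t hst => ?_⟩
  obtain ⟨h, rfl⟩ : ∃ h : ℝ≥0, t = s + h := ⟨t - s, (add_tsub_cancel_of_le hst).symm⟩
  have hdec : (fun ω => W (s + h) ω i) =
      (fun ω => W s ω i) + fun ω => W (s + h) ω i - W s ω i := by
    funext ω; simp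
  have hint : Integrable (fun ω => W (s + h) ω i - W s ω i) P :=
    ((integrable_coord hW) _ i).sub ((integrable_coord hW) _ i)
  have h1 := condExp_add ((integrable_coord hW) s i) hint (hW.natFiltration s) (μ := P)
  have h2 : P[fun ω => W s ω i | hW.natFiltration s] = fun ω => W s ω i :=
    condExp_of_stronglyMeasurable (hW.natFiltration.le s) ((stronglyAdapted_coord hW) i s)
      ((integrable_coord hW) s i)
  rw [← hdec] at h1
  show P[fun ω => W (s + h) ω i | hW.natFiltration s] =ᵐ[P] fun ω => W s ω i
  filter_upwards [h1, (condExp_coordIncr hW) s h i] with ω hω hω'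
  rw [hω, Pi.add_apply, hω', h2, Pi.zero_apply, add_zero]

/-- **`(W^i_t)² - t` is a martingale for the JOINT raw natural filtration.**
`(W^i_t)² = (W^i_s)² + 2 W^i_s (W^i_t - W^i_s) + (W^i_t - W^i_s)²`; the middle term has zero conditional
expectation (pull-out), and `E[(W^i_t - W^i_s)² | 𝓕_s] = t - s`.
Revuz–Yor, *Continuous Martingales and Brownian Motion* (1999), Ch. II, Prop. (1.2)(ii). -/
theorem martingale_coord_sq_sub [IsProbabilityMeasure P] (hW : IsBrownianVec W P) (i : Fin d) :
    Martingale (fun t ω => (W t ω i) ^ 2 - (t : ℝ)) hW.natFiltration P := by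
  refine ⟨fun t => (((stronglyAdapted_coord hW) i t).pow 2).sub stronglyMeasurable_const,
    fun s t hst => ?_⟩
  obtain ⟨h, rfl⟩ : ∃ h : ℝ≥0, t = s + h := ⟨t - s, (add_tsub_cancel_of_le hst).symm⟩
  set D : Ω → ℝ := fun ω => W (s + h) ω i - W s ω i with hD
  set Bs : Ω → ℝ := fun ω => W s ω i with hBs
  have hBs2 : Integrable (fun ω => Bs ω ^ 2) P := ((memLp_two_coord hW) s i).integrable_sq
  have hBsD : Integrable (Bs * D) P := ((memLp_two_coord hW) s i).integrable_mul
    ((memLp_two_coordIncr hW) s h i)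
  have hD2 : Integrable (fun ω => D ω ^ 2) P := ((memLp_two_coordIncr hW) s h i).integrable_sq
  have hDint : Integrable D P := ((integrable_coord hW) _ i).sub ((integrable_coord hW) _ i)
  have hdec : (fun ω => (W (s + h) ω i) ^ 2 - ((s + h : ℝ≥0) : ℝ)) =
      (fun ω => Bs ω ^ 2) + (2 : ℝ) • (Bs * D) + (fun ω => D ω ^ 2) - fun _ => ((s + h : ℝ≥0) : ℝ) := by
    ext ω
    simp only [hD, hBs, Pi.sub_apply, Pi.add_apply, Pi.smul_apply, Pi.mul_apply, smul_eq_mul]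
    ring
  have hsm : StronglyMeasurable[hW.natFiltration s] Bs := (stronglyAdapted_coord hW) i s
  have h1 : P[fun ω => Bs ω ^ 2 | hW.natFiltration s] = fun ω => Bs ω ^ 2 :=
    condExp_of_stronglyMeasurable (hW.natFiltration.le s) (hsm.pow 2) hBs2
  have h2 : P[Bs * D | hW.natFiltration s] =ᵐ[P] 0 := by
    have := condExp_mul_of_stronglyMeasurable_left hsm hBsD hDint (m := hW.natFiltration s)
    filter_upwards [this, (condExp_coordIncr hW) s h i] with ω hω hω'
    rw [hω, Pi.mul_apply, hω', Pi.zero_apply, mul_zero]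
  have h3 := (condExp_coordIncr_sq hW) s h i
  have h4 : P[fun _ => ((s + h : ℝ≥0) : ℝ) | hW.natFiltration s] = fun _ => ((s + h : ℝ≥0) : ℝ) :=
    condExp_const (hW.natFiltration.le s) _
  have hA := condExp_add hBs2 (hBsD.smul (2 : ℝ)) (hW.natFiltration s) (μ := P)
  have hB := condExp_add (hBs2.add (hBsD.smul (2 : ℝ))) hD2 (hW.natFiltration s) (μ := P)
  have hC := condExp_sub ((hBs2.add (hBsD.smul (2 : ℝ))).add hD2)
    (integrable_const ((s + h : ℝ≥0) : ℝ)) (hW.natFiltration s) (μ := P)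
  have hS := condExp_smul (2 : ℝ) (Bs * D) (hW.natFiltration s) (μ := P)
  show P[fun ω => (W (s + h) ω i) ^ 2 - ((s + h : ℝ≥0) : ℝ) | hW.natFiltration s]
    =ᵐ[P] fun ω => (W s ω i) ^ 2 - (s : ℝ)
  rw [hdec]
  filter_upwards [hA, hB, hC, hS, h2, h3] with ω hAω hBω hCω hSω h2ω h3ω
  simp only [Pi.add_apply, Pi.sub_apply, Pi.smul_apply, smul_eq_mul] at hAω hBω hCω hSω ⊢
  rw [hCω, hBω, hAω, hSω, h1, h2ω, h4, h3ω]
  simp only [Pi.zero_apply, mul_zero, add_zero, hBs, NNReal.coe_add]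
  ring

/-! ### Payoff: Itô integrals against each coordinate, w.r.t. the joint filtration -/

/-- **Vector stochastic integration on a flat Brownian noise.**  For a Brownian vector `W` and its JOINT
raw natural filtration `𝓕`, every `𝓕`-progressive real integrand `H` with `E ∫₀ᵗ H_s² ds < ∞` for all
`t` has an Itô integral `J = ∫₀ H dW^i` against the coordinate `W^i` in the sense of the tree's
characterised `IsItoIntegral` (w.r.t. `𝓕`, not the coordinate's own filtration), and `J` is a
square-integrable `𝓕`-martingale.  The tree's generic construction
`exists_isItoIntegral_of_sqErr_ne_top` (Revuz–Yor IV Thm (2.2), Prop. (2.8), (2.13)) fed with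
`martingale_coord`, `martingale_coord_sq_sub`, `memLp_two_coord`, `continuous_coord`. -/
theorem exists_isItoIntegral_coord [IsProbabilityMeasure P] (hW : IsBrownianVec W P) (i : Fin d)
    {H : ℝ≥0 → Ω → ℝ} (hH : IsStronglyProgressive hW.natFiltration H)
    (hfin : ∀ t : ℝ≥0, sqErr H 0 P t ≠ ⊤) :
    ∃ J : ℝ≥0 → Ω → ℝ, IsItoIntegral H (fun t ω => W t ω i) J hW.natFiltration P ∧
      Martingale J hW.natFiltration P ∧ ∀ t, MemLp (J t) 2 P := by
  obtain ⟨J, hJ, hJM, hJ2, -⟩ := exists_isItoIntegral_of_sqErr_ne_top (martingale_coord hW i)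
    (martingale_coord_sq_sub hW i) (memLp_two_coord hW · i) (continuous_coord hW i) hH hfin
  exact ⟨J, hJ, hJM, hJ2⟩

/-- **The Doob–Itô `L²` maximal inequality for integrals against one coordinate, joint filtration**:
`E[sup_{s ≤ t} (J_s - J'_s)²] ≤ 4 E ∫₀ᵗ (H_s - H'_s)² ds` for `J = ∫ H dW^i`, `J' = ∫ H' dW^i`
(`H, H'` progressive for `𝓕`).  The tree's generic `IsItoIntegral.lintegral_iSup_sub_sq_le`
(Revuz–Yor IV Thm (2.2) with II Thm (1.7)) fed with the coordinate martingale facts. -/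
theorem lintegral_iSup_itoIntegral_coord_sub_sq_le [IsProbabilityMeasure P] (hW : IsBrownianVec W P)
    (i : Fin d) {H H' J J' : ℝ≥0 → Ω → ℝ} (hH : IsStronglyProgressive hW.natFiltration H)
    (hH' : IsStronglyProgressive hW.natFiltration H')
    (hJ : IsItoIntegral H (fun t ω => W t ω i) J hW.natFiltration P)
    (hJ' : IsItoIntegral H' (fun t ω => W t ω i) J' hW.natFiltration P) (t : ℝ≥0) :
    ∫⁻ ω, ⨆ s ∈ Set.Iic t, ENNReal.ofReal ((J s ω - J' s ω) ^ 2) ∂P ≤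
      4 * ∫⁻ ω, (∫⁻ s in Set.Icc (0 : ℝ) t,
        ENNReal.ofReal ((H s.toNNReal ω - H' s.toNNReal ω) ^ 2)) ∂P :=
  IsItoIntegral.lintegral_iSup_sub_sq_le (martingale_coord hW i) (martingale_coord_sq_sub hW i)
    (memLp_two_coord hW · i) (continuous_coord hW i) hH hH' hJ hJ' t

end Summit.QuantumFields.YangMills.Theorems.ColdStartUniversality

end
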